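import Literature.AlgebraicGeometry.HodgeTheory.PencilStepBelowMiddleOfVerdier
import Literature.AlgebraicGeometry.HodgeTheory.SpreadSupportsOfSmoothFamily
import Literature.AlgebraicGeometry.HodgeTheory.PencilStepBelowMiddle
import HarnessLib

/-!
# The pencil step below the middle dimension HOLDS: discharge of `deCataldoMigliorini2009_mem_algebraicClasses_of_two_mul_le`

Family `hodge`, layer `Literature/AlgebraicGeometry/HodgeTheory`. Theorems only (no definition, no
named fact; D-0026).

* `mem_algebraicClasses_of_two_mul_le` — **the pencil step, unconditionally**: if every rational
  `(q,q)`-class on every smooth projective complex `m`-fold is algebraic (all `q`), then on every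
  smooth projective complex `(m+1)`-fold `X` every rational `(p,p)`-class of degree `2p ≤ m` is
  algebraic (de Cataldo–Migliorini 2009 §4, proof of Prop. 4.5, arXiv:0711.1307v1 pp. 10–11;
  Thomas 2005, proof of Prop. 2, case `k < d/2`). It is
  `mem_algebraicClasses_of_two_mul_le_of_spread_supports` (`PencilStepBelowMiddleOfVerdier`:
  Lefschetz pencil `exists_goodPencil`, the Hodge conjecture on the smooth members, spreading of the
  fibrewise supports (I), vertical support lines `exists_verticalSupportLines`, descent of the
  generators `mem_algebraicClasses_of_pencil_spread` by the inductive hypothesis in codimension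
  `p - 1`, hard Lefschetz `eq_zero_of_cupProduct_complexGysin_one_eq_zero`; strong induction on `p`)
  fed with the DISCHARGED leaf (I) `spread_supports_over_projectiveLine_holds`
  (`SpreadSupportsOfSmoothFamily`: hyperplane witness families, generic local triviality of the
  complement of the witnessed supports in the smooth part of the pencil by embedded log resolution
  and Ehresmann relative to an snc boundary, Baire on the uncountable `ℙ¹(ℂ)`, dominating good
  component, multisection, closure — Voisin II §3.3.1 and §10.2.1 with Voisin I §9.1.1 in place of
  Verdier's isotopy lemma).
* `deCataldoMigliorini2009_mem_algebraicClasses_of_two_mul_le_holds` — **the discharge** (D-0014)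
  of the named fact of `HodgeTheory/PencilStepBelowMiddle`, verbatim its body.

## Relation to the status note of `PencilStepBelowMiddle`

The module docstring of `PencilStepBelowMiddle` (review-split generation 3, 2026-08-16) classes that
module as "merged back — dead module awaiting deletion" and asks Literature seats not to attempt the
discharge, on the finding (its item 2) that every printed proof of the pencil step runs through
inputs the tree held only as unproved named facts — Lefschetz pencils / Bertini, the spreading of
fibrewise algebraic classes, purity, the blow-up formula. As of this file that finding is superseded:
each input is a theorem of the tree (`exists_goodPencil` and `exists_fiberNet_pencil_weakLefschetz_holds`;
`spread_supports_over_projectiveLine_holds`; purity `exists_ker_restrictCompl_le_span_of_isIrreducible`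
and `Deligne1974_ker_pullback_eq_ker_pullback_resolution_holds`; the blow-up formula is not needed —
weak Lefschetz for `X̃ ⊆ X × ℙ¹` and the incidence-divisor descent `mem_algebraicClasses_of_pencil_spread`
replace decomposition (19)), and the body is the unconditional theorem
`mem_algebraicClasses_of_two_mul_le` below, proved without importing the dead module. The discharge
is therefore the one-line specialisation recorded here, in a separate leaf file which nothing
imports: the `def` of `PencilStepBelowMiddle` stays byte-for-byte as accepted, its three Summits
importers are untouched, and an operator deletion of the dead module (should it still be wanted now
that the fact is proved rather than owed) only has to take this leaf with it. The Summits obligation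
stmt-HodgeConjecture-1083 (`PencilReduction`, the same body plus an unused antecedent) can be closed
from `mem_algebraicClasses_of_two_mul_le` by its own seat; this file does not touch `Summits/`.

## References

* [DecataldoMigliorini2009] M. A. de Cataldo, L. Migliorini, On singularities of primitive cohomology
  classes, Proc. AMS 137 (2009) 3593–3600, §4 Prop. 4.5 and its proof (arXiv:0711.1307v1 pp. 10–11;
  the refereed version keeps only §§1–3 and the sentence "by virtue of standard inductive arguments,
  the middle-dimensional case is the critical one", p. 3593).
* [Thomas2005Nodes] R. P. Thomas, Nodes and the Hodge conjecture, J. Algebraic Geom. 14 (2005), §2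
  Prop. 2 and its proof, case k < d/2 (arXiv:math/0212216 p. 4).
* [VoisinHodgeII2003] C. Voisin, Hodge Theory and Complex Algebraic Geometry II (2003), §2.1.1,
  §2.3.1, §3.3.1 and §10.2.1 (proof of Thm. 10.19).
* [VoisinHodgeI2002] C. Voisin, Hodge Theory and Complex Algebraic Geometry I (2002), §9.1.1,
  Thm. 6.25.
* [CharlesSchnell2014Notes] F. Charles, C. Schnell, Notes on absolute Hodge classes (2014),
  Prop. 11.3.11 (proof).
-/

noncomputable section

open CategoryTheory AlgebraicGeometry
open Literature.AlgebraicGeometry.Motives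

namespace Literature.AlgebraicGeometry.HodgeTheory

section HodgeTheory

/-- **The pencil step below the middle dimension** (de Cataldo–Migliorini 2009 §4, proof of
Prop. 4.5; Thomas 2005 §2, proof of Prop. 2, case `k < d/2`), UNCONDITIONALLY: if every rational
`(q,q)`-class on every smooth projective complex `m`-fold is algebraic (all `q`), then for `X` smooth
projective of dimension `m + 1`, every rational `(p,p)`-class `c ∈ H²ᵖ(X(ℂ); ℂ)` with `2p ≤ m` lies
in `algebraicClasses X p` — `mem_algebraicClasses_of_two_mul_le_of_spread_supports` (Lefschetz
pencil, Hodge conjecture on the members, vertical support lines, descent, hard Lefschetz) fed with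
the discharged spreading of fibrewise supports `spread_supports_over_projectiveLine_holds`.
[cite: DecataldoMigliorini2009, §4 Prop. 4.5 and its proof (arXiv:0711.1307v1 pp. 10–11)]
[cite: Thomas2005Nodes, §2 Prop. 2 and its proof, case k < d/2 (arXiv:math/0212216 p. 4)]
[cite: VoisinHodgeII2003, §2.1.1, §3.3.1 and §10.2.1 (proof of Thm. 10.19)]
[cite: VoisinHodgeI2002, §9.1.1 and Thm. 6.25] -/
theorem mem_algebraicClasses_of_two_mul_le
    ⦃m : ℕ⦄ ⦃X : SchemeOver ℂ⦄ (hX : IsSmoothProjective (m + 1) X)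
    (hHC : ∀ ⦃Y : SchemeOver ℂ⦄, IsSmoothProjective m Y → ∀ (q : ℕ) (c : complexBetti Y (2 * q)),
      IsRationalClass c → IsOfHodgeType m Y (2 * q) q q c → c ∈ algebraicClasses Y q)
    (p : ℕ) (c : complexBetti X (2 * p)) (hpm : 2 * p ≤ m) (hc : IsRationalClass c)
    (hpp : IsOfHodgeType (m + 1) X (2 * p) p p c) : c ∈ algebraicClasses X p :=
  mem_algebraicClasses_of_two_mul_le_of_spread_supports spread_supports_over_projectiveLine_holds
    hX hHC p c hpm hc hpp

/-- **Discharge of the named fact `deCataldoMigliorini2009_mem_algebraicClasses_of_two_mul_le`**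
(`HodgeTheory/PencilStepBelowMiddle`; de Cataldo–Migliorini 2009 §4, proof of Prop. 4.5,
arXiv:0711.1307v1 pp. 10–11; Thomas 2005 §2, proof of Prop. 2, case `k < d/2`): verbatim its body,
`mem_algebraicClasses_of_two_mul_le`.
[cite: DecataldoMigliorini2009, §4 Prop. 4.5 and its proof (arXiv:0711.1307v1 pp. 10–11)]
[cite: Thomas2005Nodes, §2 Prop. 2 and its proof, case k < d/2 (arXiv:math/0212216 p. 4)] -/
theorem deCataldoMigliorini2009_mem_algebraicClasses_of_two_mul_le_holds :
    deCataldoMigliorini2009_mem_algebraicClasses_of_two_mul_le :=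
  fun _ _ hX hHC p c hpm hc hpp ↦ mem_algebraicClasses_of_two_mul_le hX hHC p c hpm hc hpp

end HodgeTheory

end Literature.AlgebraicGeometry.HodgeTheory

end
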